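import Mathlib
import HarnessLib
import Summits.QuantumAdvantage.QuantumAdvantage.Theorems.DigitDialE
import Summits.QuantumAdvantage.QuantumAdvantage.Theorems.DigitDialF

set_option linter.dupNamespace false
set_option autoImplicit false

/-!
# DigitDial (G) — JUNTA ⊕ YOUNG-SYMMETRIC low-degree `𝔽_p`-strategies lose the odd-prime u-walk game (cell decomp-qadv,
# lens 4, g20 rev 4)

Prop-definition-free tree twin of §8b of the lens-4 g20 node `DigitDial`.
* `hybridJ`, `juntaYoung_factor`, `youngJunta_card_win_le_fin` — for a prime `p ≠ 3`, degree `d < p^K`, a junta `J` and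
  `B` pairwise disjoint blocks disjoint from `J` covering `Jᶜ`, each of size `≥ s ≥ 4p^{2K}((|J|+B)p^K + 4)`: every strategy
  all of whose output bits have degree `≤ d` and are symmetric on every block (ARBITRARY on `J`) wins on `≤ (7/8)·2ⁿ`
  (`DigitDialE` window-Lucas on the blocks + `DigitDialF.card_win_jlStrat_le` with the coordinate forms of `J`).
0 sorry; axioms standard; no `instance`, no `notation`, no `native_decide`; no `def … : Prop`.
-/

noncomputable section

namespace Summit.QuantumAdvantage.QuantumAdvantage.Theorems.DigitDial

open Finset Summit.QuantumAdvantage.AdviceFreeQNC0 Literature.Computability.MetaComplexity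
open TwistedTransfer ConstBells

section JuntaYoung

open Smolensky

variable {n : ℕ}

/-- **Junta ⊕ Young-symmetric low-degree strategies lose** (finite form): prime `p ≠ 3`, a junta `J` with `|J| + 4 ≤ n`,
`B` pairwise disjoint blocks, disjoint from `J`, covering `Jᶜ`, each of size `≥ s ≥ 4p^{2K}((|J|+B)p^K + 4)`; every strategy
whose output bits depend ARBITRARILY on `u|_J`, symmetrically on each block, and have `𝔽_p`-degree `≤ d < p^K`, wins the u-walk
game on `≤ (7/8)·2ⁿ` inputs. -/
theorem youngJunta_card_win_le_fin {p : ℕ} [hp : Fact p.Prime] (hp3 : p ≠ 3) {d K B : ℕ}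
    (J : Finset (Fin n)) (hJ : J.card + 4 ≤ n) (hd : d < p ^ K) (W : Fin B → Finset (Fin n))
    (hdisj : ∀ b b', b ≠ b' → Disjoint (W b) (W b')) (hWJ : ∀ b, Disjoint (W b) J)
    (hcover : ∀ i, i ∉ J → ∃ b, i ∈ W b) {s : ℕ} (hsize : ∀ b, s ≤ (W b).card)
    (hs : 4 * (p ^ K) ^ 2 * ((J.card + B) * p ^ K + 4) ≤ s)
    (c : ℕ) (y : Fin (n + 1) → (Fin n → Bool) → Bool)
    (hys : ∀ g b, ∀ u v : Fin n → Bool, (∀ i, i ∉ W b → u i = v i) → wtOn (W b) u = wtOn (W b) v → y g u = y g v)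
    (hyd : ∀ g, HasDegF p (y g) d) :
    ((univ.filter fun u : Fin n → Bool => ringWinU c y u = true).card : ℝ) ≤ (7 / 8) * (2 : ℝ) ^ n := by
  classical
  haveI : NeZero (p ^ K) := ⟨pow_ne_zero _ hp.out.ne_zero⟩
  have hcop : (p ^ K).Coprime 3 :=
    Nat.Coprime.pow_left _ ((Nat.coprime_primes hp.out Nat.prime_three).2 hp3)
  -- the full partition: the blocks `W_b` and the singletons of `J`
  set W' : Fin (B + J.card) → Finset (Fin n) :=
    Fin.append W (fun a : Fin J.card => ({(J.equivFin.symm a : Fin n)} : Finset (Fin n))) with hW'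
  have hW'left : ∀ b : Fin B, W' (Fin.castAdd J.card b) = W b := fun b => by
    rw [hW']; exact Fin.append_left W _ b
  have hW'right : ∀ a : Fin J.card, W' (Fin.natAdd B a) = {(J.equivFin.symm a : Fin n)} := fun a => by
    rw [hW']; exact Fin.append_right W _ a
  have hdisj' : ∀ k k', k ≠ k' → Disjoint (W' k) (W' k') := by
    intro k k' hkk'
    induction k using Fin.addCases with
    | left b =>
      induction k' using Fin.addCases with
      | left b' =>
        rw [hW'left, hW'left]
        exact hdisj b b' fun h => hkk' (by rw [h])
      | right a' =>
        rw [hW'left, hW'right, Finset.disjoint_singleton_right]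
        exact fun h => Finset.disjoint_left.1 (hWJ b) h (J.equivFin.symm a').2
    | right a =>
      induction k' using Fin.addCases with
      | left b' =>
        rw [hW'left, hW'right, Finset.disjoint_singleton_left]
        exact fun h => Finset.disjoint_left.1 (hWJ b') h (J.equivFin.symm a).2
      | right a' =>
        rw [hW'right, hW'right, Finset.disjoint_singleton_left, Finset.mem_singleton]
        intro h
        apply hkk'
        have : a = a' := J.equivFin.symm.injective (Subtype.ext h)
        rw [this]
  have hcover' : ∀ i, ∃ k, i ∈ W' k := by
    intro i
    by_cases hi : i ∈ J
    · refine ⟨Fin.natAdd B (J.equivFin ⟨i, hi⟩), ?_⟩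
      rw [hW'right, Finset.mem_singleton]
      simp
    · obtain ⟨b, hb⟩ := hcover i hi
      exact ⟨Fin.castAdd J.card b, by rw [hW'left]; exact hb⟩
  -- symmetry on the singleton blocks is automatic
  have hys' : ∀ g k, ∀ u v : Fin n → Bool, (∀ i, i ∉ W' k → u i = v i) → wtOn (W' k) u = wtOn (W' k) v →
      y g u = y g v := by
    intro g k u v hout hwt
    induction k using Fin.addCases with
    | left b => rw [hW'left] at hout hwt; exact hys g b u v hout hwt
    | right a =>
      rw [hW'right] at hout hwt
      have huv : u = v := by
        funext i
        by_cases hi : i = (J.equivFin.symm a : Fin n)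
        · -- the single window coordinate: equal weights on a singleton force equal bits
          unfold wtOn at hwt
          rw [Finset.filter_singleton, Finset.filter_singleton] at hwt
          subst hi
          by_cases hu : u (J.equivFin.symm a : Fin n) = true <;>
            by_cases hv : v (J.equivFin.symm a : Fin n) = true <;> simp_all
        · exact hout i (by rwa [Finset.mem_singleton])
      rw [huv]
  -- every output bit reads the block forms of `W'` mod `p^K`
  choose tab htab using fun g => blockSymm_factor hd W' hdisj' hcover' (hys' g) (hyd g)
  -- the block forms of `W'` = (block forms of `W`, coordinate forms of `J`) — as a junta ⊕ forms strategy
  set tab₂ : Fin (n + 1) → (Fin J.card → ZMod (p ^ K)) → (Fin B → ZMod (p ^ K)) → Bool :=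
    fun g α v => tab g (Fin.append v α) with htab₂
  have hval : ∀ u : Fin n → Bool, linVal (blockForm (p ^ K) W') u =
      Fin.append (linVal (blockForm (p ^ K) W) u) (linVal (coordForm (p ^ K) J) u) := by
    intro u
    funext k
    induction k using Fin.addCases with
    | left b =>
      rw [Fin.append_left]
      unfold linVal blockForm
      simp_rw [hW'left]
    | right a =>
      rw [Fin.append_right]
      unfold linVal blockForm coordForm
      simp_rw [hW'right, Finset.mem_singleton]
  have hy : y = jlStrat (coordForm (p ^ K) J) (blockForm (p ^ K) W) tab₂ := by
    funext g u
    rw [htab g u]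
    unfold jlStrat
    rw [htab₂]
    simp only
    rw [hval u]
  rw [hy]
  have hmain := card_win_jlStrat_le hcop c J hJ (coordForm (p ^ K) J) (fun a i hi => coordForm_support J a i hi)
    (blockForm (p ^ K) W) (fun α γ hγ => blockForm_dist_junta J W hdisj hWJ hsize α γ hγ) tab₂
  have hsmall := pow_twist_small (p ^ K) (J.card + B) s (Nat.one_le_pow _ _ hp.out.pos) hs
  have h2n : (0 : ℝ) ≤ (2 : ℝ) ^ n := by positivity
  nlinarith

end JuntaYoung

end Summit.QuantumAdvantage.QuantumAdvantage.Theorems.DigitDial
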